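import Summits.CriticalPhenomena.PercolationContinuityZ3.Theorems.PercNearOneGluingNoHeavyQuantGatedSliceMixLawExchange
import HarnessLib

/-!
# QUANT lane R8, T-DEC, leg (III), blob case — `LawDec.GatedSliceMixLaw'` in REGIME B (the weak-mid law's shifted atom `h + a` is a
# GIANT), TOOLS for cell B-G (`k₂` a giant): the usage bound `usage(ℓ,m)·(m − S) ≤ t − ℓ`, the ρ-free real inequality S1 behind the
# second kink, `(1−z)λ ≥ uz`, and `W_h` DEC when its giant covers its zero (companion `…QuantGatedSliceMixLawRegimeBCheap`)

builds on p205010 (kernel theorem, internal audit signed; external expert review pending)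

Support file (`--supports stmt-CriticalPhenomena-4575`), QUANT lane lead seat (gen 32), rung R8 of `run/shared/lean/prim/quant/LADDER.md`.
Memo `run/shared/lean/prim/quant/prim-quant-lead-g32/FOR-PROVERS-MIXLAW-KINKS.md` §2.  Theorems only, standard axioms, no sorries.
Tools: typer g30's `…QuantGatedSliceMixLawExchange` (pair / point flows, the cone structure of `FlowAtT`, the explicit moved two-point law,
the conclusion wrapper), `flowAtT_of_giants` (criterion E), `usage_mid_eq` (closed form of the usage rate).

THE CELL.  Frame of `GatedSliceMixLaw'` (`t = S + ag(1−z)`); regime B: `h + a ≥ j + 1` (so `W_h = (1 − S/h)δ₀ + (S/h)(1−g)δ_h + (S/h)g δ_{h+a}`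
has ONE mid `h` and one giant); `k₂ ≥ j + 1` (both absorbers `k₂`, `k₂ + a` of the moved law `P[μ₂]` are giants); `d = k₁ + a` a `t`-low
(`2d < t`, `d ≤ j`), `h` a mid (`2h ≥ t`).  The mixture `Q_θ = θ·W_h + (1−θ)·P[μ₂]` has lows `0, k₁, d`, ONE mid
`h` and a pool of giants, so its DEC problem is a fractional knapsack whose optimum is the deepest-first greedy; its budget is concave piecewise
affine in `θ` with kinks K1 (`h` exactly full of `d`; arm-3 g64's (K), typer g29's budget point, lead g31's N121) and K2 (`h` exactly full of
`d` AND `k₁`).  Lead g32's census (route2/route3/cellBG, ≈ 3·10⁶ exact instances, M ≤ 40): K1 certifies every instance of the cell in which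
`k₁` is DEAR at `h` (`k₁ + h ≤ t` or `ρ₁ = (t − 2k₁)/(h − k₁) ≥ y`) and FAILS for genuine instances in the corner `h ≫ t` where `k₁` is CHEAP at
`h` (`ρ₁ < y`: the pair `(k₁, h)` is light and costs less than a giant) — e.g. `y = 1/3, z = 0, g = 1/3, S = 4, a = 1, j = 11, M = 12, h = 11,
μ₂ = {1, 12; 3/11}` (exact `θ`-interval `[17/122, 2374/2605]`, K1 `= 0.1357` outside, K2 `= 0.469` inside); there K2 certifies (0 / 64 699).
THIS FILE holds the tools; the companion `…QuantGatedSliceMixLawRegimeBCheap` proves the cheap sub-cell with them: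

* `LawDec.usage_mul_sub_le_light_or` — for a `t`-low `ℓ` and a compatible mid `m ≤ j` with `y·m ≤ S < m`, `S ≤ t`, and (`ρ < y` or `t − S ≤ ℓ`):
  `usage y t j ℓ m · (m − S) ≤ t − ℓ` (light metric: `−(yD − p)² + ℓ(D(1+y−y²) − p(2−y)) ≥ ℓD(1−y)` from `yD − p ≤ (2−y)ℓ`; heavy metric:
  `(t−ℓ)(t−S−ℓ) ≤ 0 ≤ ℓ(m−S)`; `D = m − ℓ`, `p = t − 2ℓ`).
* `LawDec.mixLawB_S1` — the ρ-free inequality `(1−z)(1−λ)(S − k₁ − agz)(u(h−S) − Sg) ≤ S(1−g)(h−S)((1−z)λ − uz)`, `u = y/(1−y)`, from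
  top-affordability `y·k₂ ≤ S`, `y·h ≤ S`, `y + z ≤ 1`, `S − k₁ − az ≥ 0` (affine in `k₂`, monotone to the corner `k₂ = S/y` where the slack is
  `S(1−y−z)/(y(1−y))·g[(S−yh)(S−k₁−az) + azS(1−y)(1−g)] ≥ 0`); `LawDec.mixLawB_QG` — `(1−z)λ ≥ uz` on the cell.
* `LawDec.decAtT_weakMidLaw_of_giant` — in regime B, `u(1 − S/h) ≤ (S/h)g` makes `W_h` DEC (so `¬DEC(W_h)` gives the assembler `g < 1`);
  `LawDec.sum_mul_indicator_eq_zero` (bookkeeping).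
* Companion: **`LawDec.gatedSliceMixLaw_regimeB_cheap`** (cell B-G, `t < k₁ + h`, `(t − 2k₁) < y(h − k₁)`, `g < 1`) at the kink `θ = K2`.

[this work]; exchange architecture: prim-quant-stmt g30; flow form / criterion E / usage closed forms: prim-quant-stmt g22–g27, arm-1 g39, lead g21
(this lane); cell map: arm-3 g63–g64, lead g31–g32.  Nothing here is cited as a published result.  The gluing rows served
[cite: KozmaNitzan2024, Conjecture 3 (p. 15)]; product measure [cite: Grimmett1999, §1.3 p. 10].
-/

noncomputable section

namespace Summit.CriticalPhenomena.PercolationContinuityZ3.Theorems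

namespace Quant

open Finset

/-- the two-point law `{lo, hi; g}` (as in `…QuantLawDEC`) -/
local notation3 "TP[" lo ", " hi ", " g ", " h "]" =>
  (g : ℝ) * (if (h : ℕ) = (hi : ℕ) then (1 : ℝ) else 0) + (1 - (g : ℝ)) * (if (h : ℕ) = (lo : ℕ) then (1 : ℝ) else 0)

namespace LawDec

/-! ### The usage bound `usage(ℓ, m)·(m − S) ≤ t − ℓ` -/

/-- **usage bound against `m − S`.**  For `0 < y < 1`, a `t`-low `ℓ` (`2ℓ < t`), a mid `m ≤ j` compatible with it (`t < ℓ + m`), with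
`y·m ≤ S < m`, `S ≤ t`, and EITHER the pair light (`t − 2ℓ < y(m − ℓ)`) OR `t − S ≤ ℓ`: `usage y t j ℓ m · (m − S) ≤ t − ℓ`.  (Typer g30's
`usage_mul_sub_le` in `…MixLawC2` is the second alternative; the light alternative is what the low `k₁` of regime B needs.) [this work] -/
theorem usage_mul_sub_le_light_or (y t S : ℝ) (j l m : ℕ) (hy0 : 0 < y) (hy1 : y < 1) (hlow : 2 * (l : ℝ) < t) (hmj : m ≤ j)
    (hcomp : t < (l : ℝ) + m) (hym : y * (m : ℝ) ≤ S) (hSm : S < (m : ℝ)) (hSt : S ≤ t)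
    (hcase : t - 2 * (l : ℝ) < y * ((m : ℝ) - l) ∨ t - S ≤ (l : ℝ)) :
    usage y t j l m * ((m : ℝ) - S) ≤ t - l := by
  have hl0 : (0 : ℝ) ≤ l := Nat.cast_nonneg l
  have h1y : 0 < 1 - y := by linarith
  rw [usage_mid_eq y t j l m hy0 hy1 hmj hlow hcomp]
  -- abbreviations: p = t − 2ℓ > 0, D = m − ℓ > p
  have hp : 0 < t - 2 * (l : ℝ) := by linarith
  have hDp : t - 2 * (l : ℝ) < (m : ℝ) - l := by linarith
  have hD : 0 < (m : ℝ) - l := lt_trans hp hDp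
  have hdenH : 0 < (l : ℝ) + m - t := by linarith
  have hdenL : 0 < (1 - y) * ((1 - y) * (l : ℝ) + (1 + y) * m - t) := by
    apply mul_pos h1y; nlinarith
  have hmS : 0 < (m : ℝ) - S := by linarith
  -- the TA consequence `y(m − ℓ) − (t − 2ℓ) ≤ (2 − y)ℓ`
  have hyD : y * ((m : ℝ) - l) - (t - 2 * (l : ℝ)) ≤ (2 - y) * l := by nlinarith
  -- light metric bound, valid whenever the pair is light
  have hL : t - 2 * (l : ℝ) < y * ((m : ℝ) - l) →
      (y ^ 2 * ((m : ℝ) - l) + (1 - y) * (t - 2 * (l : ℝ))) / ((1 - y) * ((1 - y) * (l : ℝ) + (1 + y) * m - t)) * ((m : ℝ) - S)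
        ≤ t - l := by
    intro hlt
    rw [div_mul_eq_mul_div, div_le_iff₀ hdenL]
    -- (1−y)[(p+ℓ)((1+y)D − p) − m(y²D + (1−y)p)] + (S − ym)(y²D + (1−y)p) ≥ 0
    have key : (t - l) * ((1 - y) * ((1 - y) * (l : ℝ) + (1 + y) * m - t))
        - (y ^ 2 * ((m : ℝ) - l) + (1 - y) * (t - 2 * (l : ℝ))) * ((m : ℝ) - S)
        = (1 - y) * (-(y * ((m : ℝ) - l) - (t - 2 * (l : ℝ))) ^ 2
            + (l : ℝ) * (((m : ℝ) - l) * (1 + y - y ^ 2) - (t - 2 * (l : ℝ)) * (2 - y)))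
          + (S - y * (m : ℝ)) * (y ^ 2 * ((m : ℝ) - l) + (1 - y) * (t - 2 * (l : ℝ))) := by
      ring
    have hpos1 : 0 ≤ (S - y * (m : ℝ)) * (y ^ 2 * ((m : ℝ) - l) + (1 - y) * (t - 2 * (l : ℝ))) :=
      mul_nonneg (by linarith) (by positivity)
    have hsq : (y * ((m : ℝ) - l) - (t - 2 * (l : ℝ))) ^ 2 ≤ (2 - y) * l * (y * ((m : ℝ) - l) - (t - 2 * (l : ℝ))) := by
      have h0 : 0 ≤ y * ((m : ℝ) - l) - (t - 2 * (l : ℝ)) := by linarith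
      nlinarith
    have hbr : (l : ℝ) * (((m : ℝ) - l) * (1 - y)) ≤
        -(y * ((m : ℝ) - l) - (t - 2 * (l : ℝ))) ^ 2 + (l : ℝ) * (((m : ℝ) - l) * (1 + y - y ^ 2) - (t - 2 * (l : ℝ)) * (2 - y)) := by
      nlinarith
    have hpos2 : 0 ≤ (l : ℝ) * (((m : ℝ) - l) * (1 - y)) := mul_nonneg hl0 (mul_nonneg hD.le h1y.le)
    nlinarith
  -- the comparison of the two metrics: `(D − p)(y²D + (1−y)p) − p(1−y)((1+y)D − p) = yD(yD − p)`
  have cmp : ((m : ℝ) - l - (t - 2 * (l : ℝ))) * (y ^ 2 * ((m : ℝ) - l) + (1 - y) * (t - 2 * (l : ℝ)))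
      - (t - 2 * (l : ℝ)) * ((1 - y) * ((1 + y) * ((m : ℝ) - l) - (t - 2 * (l : ℝ))))
      = y * ((m : ℝ) - l) * (y * ((m : ℝ) - l) - (t - 2 * (l : ℝ))) := by ring
  by_cases hlt : t - 2 * (l : ℝ) < y * ((m : ℝ) - l)
  · -- light: u_H ≤ u_L ≤ bound
    have hHL : (t - 2 * (l : ℝ)) / ((l : ℝ) + m - t)
        ≤ (y ^ 2 * ((m : ℝ) - l) + (1 - y) * (t - 2 * (l : ℝ))) / ((1 - y) * ((1 - y) * (l : ℝ) + (1 + y) * m - t)) := by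
      rw [div_le_div_iff₀ hdenH hdenL]
      have h0 : 0 ≤ y * ((m : ℝ) - l) * (y * ((m : ℝ) - l) - (t - 2 * (l : ℝ))) :=
        mul_nonneg (mul_nonneg hy0.le hD.le) (by linarith)
      nlinarith
    have hLb := hL hlt
    calc max ((t - 2 * (l : ℝ)) / ((l : ℝ) + m - t))
          ((y ^ 2 * ((m : ℝ) - l) + (1 - y) * (t - 2 * (l : ℝ))) / ((1 - y) * ((1 - y) * (l : ℝ) + (1 + y) * m - t))) * ((m : ℝ) - S)
        = (y ^ 2 * ((m : ℝ) - l) + (1 - y) * (t - 2 * (l : ℝ))) / ((1 - y) * ((1 - y) * (l : ℝ) + (1 + y) * m - t)) * ((m : ℝ) - S) := by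
          rw [max_eq_right hHL]
      _ ≤ t - l := hLb
  · -- heavy: u_L ≤ u_H ≤ bound, using `t − S ≤ ℓ`
    have hge : y * ((m : ℝ) - l) ≤ t - 2 * (l : ℝ) := not_lt.1 hlt
    have hlS : t - S ≤ (l : ℝ) := by
      rcases hcase with h | h
      · exact absurd h hlt
      · exact h
    have hLH : (y ^ 2 * ((m : ℝ) - l) + (1 - y) * (t - 2 * (l : ℝ))) / ((1 - y) * ((1 - y) * (l : ℝ) + (1 + y) * m - t))
        ≤ (t - 2 * (l : ℝ)) / ((l : ℝ) + m - t) := by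
      rw [div_le_div_iff₀ hdenL hdenH]
      have h0 : y * ((m : ℝ) - l) * (y * ((m : ℝ) - l) - (t - 2 * (l : ℝ))) ≤ 0 :=
        mul_nonpos_of_nonneg_of_nonpos (mul_nonneg hy0.le hD.le) (by linarith)
      nlinarith
    have hHb : (t - 2 * (l : ℝ)) / ((l : ℝ) + m - t) * ((m : ℝ) - S) ≤ t - l := by
      rw [div_mul_eq_mul_div, div_le_iff₀ hdenH]
      -- (t−ℓ)(ℓ+m−t) − (t−2ℓ)(m−S) = ℓ(m−ℓ) − (t−2ℓ)(t−S)... ≥ 0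
      have key : (t - l) * ((l : ℝ) + m - t) - (t - 2 * (l : ℝ)) * ((m : ℝ) - S)
          = (l : ℝ) * ((m : ℝ) - l) - (t - 2 * (l : ℝ)) * (t - S) := by ring
      have h1 : (t - 2 * (l : ℝ)) * (t - S) ≤ (l : ℝ) * ((m : ℝ) - l) := by
        have := mul_le_mul hDp.le hlS (by linarith) hD.le
        linarith [this]
      nlinarith
    calc max ((t - 2 * (l : ℝ)) / ((l : ℝ) + m - t))
          ((y ^ 2 * ((m : ℝ) - l) + (1 - y) * (t - 2 * (l : ℝ))) / ((1 - y) * ((1 - y) * (l : ℝ) + (1 + y) * m - t))) * ((m : ℝ) - S)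
        = (t - 2 * (l : ℝ)) / ((l : ℝ) + m - t) * ((m : ℝ) - S) := by rw [max_eq_left hLH]
      _ ≤ t - l := hHb


/-! ### The two real inequalities of the cell -/

/-- **`(1−z)λ ≥ u·z` on the cell** (`u = y/(1−y)`): from the mean identity, `y·k₂ ≤ S`, `k₁ ≤ S`, `y + z ≤ 1`. [this work] -/
theorem mixLawB_QG (y z S lam k₁ k₂ : ℝ) (hy0 : 0 < y) (hy1 : y < 1) (hz0 : 0 ≤ z) (hyz : y + z ≤ 1)
    (hk : k₁ < k₂) (hSk₁ : k₁ ≤ S) (hyk₂ : y * k₂ ≤ S)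
    (hmean : (1 - z) * (k₁ + (k₂ - k₁) * lam) = S) :
    y / (1 - y) * z ≤ (1 - z) * lam := by
  have h1y : 0 < 1 - y := by linarith
  have hK : 0 < k₂ - k₁ := by linarith
  -- (1−z)λ(k₂−k₁) = S − (1−z)k₁ ≥ u z (k₂ − k₁)
  have eA : (1 - z) * lam * (k₂ - k₁) = S - (1 - z) * k₁ := by linear_combination hmean
  have huk₂ : y / (1 - y) * z * k₂ ≤ z * S / (1 - y) := by
    rw [div_mul_eq_mul_div, div_mul_eq_mul_div, div_le_div_iff_of_pos_right h1y]
    nlinarith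
  have key : y / (1 - y) * z * (k₂ - k₁) ≤ S - (1 - z) * k₁ := by
    have e1 : S - (1 - z) * k₁ - (z * S / (1 - y) - y / (1 - y) * z * k₁) = (1 - y - z) * (S - k₁) / (1 - y) := by
      field_simp; ring
    have hnn : 0 ≤ (1 - y - z) * (S - k₁) / (1 - y) := div_nonneg (mul_nonneg (by linarith) (by linarith)) h1y.le
    nlinarith
  exact le_of_mul_le_mul_right (show y / (1 - y) * z * (k₂ - k₁) ≤ (1 - z) * lam * (k₂ - k₁) by rw [eA]; exact key) hK

set_option maxHeartbeats 400000 in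
/-- **the ρ-free inequality S1 of cell B-G** (`u = y/(1−y)`):
`(1−z)(1−λ)(S − k₁ − agz)·(u(h−S) − Sg) ≤ S(1−g)(h−S)·((1−z)λ − uz)`.  PROOF: multiply by `k₂ − k₁`; the difference RHS − LHS is
affine in `k₂` and at the top-affordability corner `k₂ = S/y` equals `S(1−y−z)/(y(1−y))·g[(S−yh)(S−k₁−az) + azS(1−y)(1−g)] ≥ 0`; if
`u(h−S) ≥ Sg` it decreases in `k₂ ≤ S/y`, otherwise LHS ≤ 0 ≤ RHS (`mixLawB_QG`'s numerator). [this work] -/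
theorem mixLawB_S1 (y z g S lam h a k₁ k₂ : ℝ) (hy0 : 0 < y) (hy1 : y < 1) (hz0 : 0 ≤ z) (hyz : y + z ≤ 1)
    (hg0 : 0 ≤ g) (hg1 : g ≤ 1) (ha0 : 0 ≤ a) (hS0 : 0 < S) (hSh : S < h) (hyh : y * h ≤ S)
    (hk : k₁ < k₂) (hyk₂ : y * k₂ ≤ S) (hTk₂ : S ≤ (1 - z) * k₂) (hSk₁ : 0 ≤ S - k₁ - a * z)
    (hmean : (1 - z) * (k₁ + (k₂ - k₁) * lam) = S) :
    (1 - z) * (1 - lam) * (S - k₁ - a * g * z) * (y / (1 - y) * (h - S) - S * g)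
      ≤ S * (1 - g) * (h - S) * ((1 - z) * lam - y / (1 - y) * z) := by
  have h1y : 0 < 1 - y := by linarith
  have hK : 0 < k₂ - k₁ := by linarith
  have hhS : 0 < h - S := by linarith
  have haz : 0 ≤ a * z := mul_nonneg ha0 hz0
  have hSk₁' : 0 ≤ S - k₁ := by linarith
  have hagz : a * g * z ≤ a * z := by nlinarith [mul_nonneg haz hg0]
  have hN : 0 ≤ S - k₁ - a * g * z := by linarith
  set u : ℝ := y / (1 - y) with hu
  have hu0 : 0 < u := div_pos hy0 h1y
  have huy : u * (1 - y) = y := by rw [hu]; field_simp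
  have eA1 : (1 - z) * lam * (k₂ - k₁) = S - (1 - z) * k₁ := by linear_combination hmean
  have eA2 : (1 - z) * (1 - lam) * (k₂ - k₁) = (1 - z) * k₂ - S := by linear_combination -hmean
  have hA2 : 0 ≤ (1 - z) * k₂ - S := by linarith
  -- it suffices to prove the inequality multiplied by K = k₂ − k₁
  refine le_of_mul_le_mul_right ?_ hK
  have eL : (1 - z) * (1 - lam) * (S - k₁ - a * g * z) * (u * (h - S) - S * g) * (k₂ - k₁)
      = ((1 - z) * k₂ - S) * ((S - k₁ - a * g * z) * (u * (h - S) - S * g)) := by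
    rw [← eA2]; ring
  have eR : S * (1 - g) * (h - S) * ((1 - z) * lam - u * z) * (k₂ - k₁)
      = S * (1 - g) * (h - S) * (S - (1 - z) * k₁ - u * z * (k₂ - k₁)) := by
    rw [← eA1]; ring
  rw [eL, eR]
  -- the numerator of `(1−z)λ − uz` is at least its value at k₂ = S/y
  have huk₂ : u * z * k₂ ≤ z * S / (1 - y) := by
    rw [hu, div_mul_eq_mul_div, div_mul_eq_mul_div, div_le_div_iff_of_pos_right h1y]
    nlinarith
  have hR1 : (1 - y - z) * (S - k₁) / (1 - y) ≤ S - (1 - z) * k₁ - u * z * (k₂ - k₁) := by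
    have e1 : S - (1 - z) * k₁ - (z * S / (1 - y) - u * z * k₁) = (1 - y - z) * (S - k₁) / (1 - y) := by
      rw [hu]; field_simp; ring
    have e2 : u * z * (k₂ - k₁) = u * z * k₂ - u * z * k₁ := by ring
    rw [e2]; linarith
  have hR0 : 0 ≤ (1 - y - z) * (S - k₁) / (1 - y) := div_nonneg (mul_nonneg (by linarith) hSk₁') h1y.le
  have hC0 : 0 ≤ S * (1 - g) * (h - S) := mul_nonneg (mul_nonneg hS0.le (by linarith)) hhS.le
  by_cases hX : 0 ≤ u * (h - S) - S * g
  · -- LHS ≤ its value at k₂ = S/y ≤ RHS at k₂ = S/y ≤ RHS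
    have hA2le : (1 - z) * k₂ - S ≤ S * (1 - y - z) / y := by
      rw [le_div_iff₀ hy0]
      have h1z : 0 ≤ 1 - z := by linarith
      have := mul_le_mul_of_nonneg_left hyk₂ h1z
      nlinarith [this]
    have hX0 : 0 ≤ (S - k₁ - a * g * z) * (u * (h - S) - S * g) := mul_nonneg hN hX
    have step1 : ((1 - z) * k₂ - S) * ((S - k₁ - a * g * z) * (u * (h - S) - S * g))
        ≤ S * (1 - y - z) / y * ((S - k₁ - a * g * z) * (u * (h - S) - S * g)) :=
      mul_le_mul_of_nonneg_right hA2le hX0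
    have step2 : S * (1 - g) * (h - S) * ((1 - y - z) * (S - k₁) / (1 - y))
        ≤ S * (1 - g) * (h - S) * (S - (1 - z) * k₁ - u * z * (k₂ - k₁)) :=
      mul_le_mul_of_nonneg_left hR1 hC0
    -- the corner comparison: (S−k₁−agz)(y(h−S) − (1−y)Sg) ≤ y(1−g)(h−S)(S−k₁), slack g[(S−yh)(S−k₁−az) + azS(1−y)(1−g)]
    have corner : (S - k₁ - a * g * z) * (y * (h - S) - (1 - y) * S * g) ≤ y * (1 - g) * (h - S) * (S - k₁) := by
      have key : y * (1 - g) * (h - S) * (S - k₁) - (S - k₁ - a * g * z) * (y * (h - S) - (1 - y) * S * g)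
          = g * ((S - y * h) * (S - k₁ - a * z) + a * z * S * (1 - y) * (1 - g)) := by ring
      have h1 : 0 ≤ (S - y * h) * (S - k₁ - a * z) := mul_nonneg (by linarith) hSk₁
      have h2 : 0 ≤ a * z * S * (1 - y) * (1 - g) := by
        have := mul_nonneg (mul_nonneg (mul_nonneg haz hS0.le) h1y.le) (show (0:ℝ) ≤ 1 - g by linarith)
        linarith
      have h3 := mul_nonneg hg0 (add_nonneg h1 h2)
      linarith [key, h3]
    -- rescale the corner comparison by S(1−y−z)/(y(1−y)) ≥ 0
    have hXe : u * (h - S) - S * g = (y * (h - S) - (1 - y) * S * g) / (1 - y) := by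
      rw [hu]; field_simp
    have hfac : 0 ≤ S * (1 - y - z) := mul_nonneg hS0.le (by linarith)
    have step3 : S * (1 - y - z) / y * ((S - k₁ - a * g * z) * (u * (h - S) - S * g))
        ≤ S * (1 - g) * (h - S) * ((1 - y - z) * (S - k₁) / (1 - y)) := by
      rw [hXe]
      have e3 : S * (1 - y - z) / y * ((S - k₁ - a * g * z) * ((y * (h - S) - (1 - y) * S * g) / (1 - y)))
          = S * (1 - y - z) / (y * (1 - y)) * ((S - k₁ - a * g * z) * (y * (h - S) - (1 - y) * S * g)) := by
        field_simp
      have e4 : S * (1 - g) * (h - S) * ((1 - y - z) * (S - k₁) / (1 - y))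
          = S * (1 - y - z) / (y * (1 - y)) * (y * (1 - g) * (h - S) * (S - k₁)) := by
        field_simp
      rw [e3, e4]
      exact mul_le_mul_of_nonneg_left corner (div_nonneg hfac (mul_pos hy0 h1y).le)
    linarith
  · -- LHS ≤ 0 ≤ RHS
    have hXn : u * (h - S) - S * g < 0 := not_le.1 hX
    have hL : ((1 - z) * k₂ - S) * ((S - k₁ - a * g * z) * (u * (h - S) - S * g)) ≤ 0 :=
      mul_nonpos_of_nonneg_of_nonpos hA2 (mul_nonpos_of_nonneg_of_nonpos hN hXn.le)
    have hR : 0 ≤ S * (1 - g) * (h - S) * (S - (1 - z) * k₁ - u * z * (k₂ - k₁)) :=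
      mul_nonneg hC0 (le_trans hR0 hR1)
    linarith


/-! ### Bookkeeping: indicator sums -/

/-- an indicator atom above the range contributes nothing. [folklore] -/
theorem sum_mul_indicator_eq_zero (F : ℕ → ℝ) (N k : ℕ) (hk : N < k) :
    ∑ p ∈ Finset.range (N + 1), F p * (if p = k then (1 : ℝ) else 0) = 0 := by
  refine Finset.sum_eq_zero fun p hp => ?_
  have : p ≠ k := by
    have := Finset.mem_range.1 hp
    omega
  rw [if_neg this, mul_zero]

/-! ### `W_h` is DEC in regime B as soon as its giant covers its zero (so `¬DEC(W_h)` gives `g < 1` to the assembler) -/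

/-- **in regime B, `u·(1 − S/h) ≤ (S/h)·g` makes `W_h` DEC** (`h` a mid, `h + a ≥ j+1`, `h ≤ M`): the zero rides the giant `h + a`
(criterion E).  In particular `g = 1` (then `u(1 − S/h) ≤ S/h` from `y·h ≤ S`) is excluded by `¬DECAtT … (weakMidLaw S g h a)`. [this work] -/
theorem decAtT_weakMidLaw_of_giant (y z g S : ℝ) (a j M h : ℕ) (hy0 : 0 < y) (hy1 : y < 1) (hg0 : 0 ≤ g) (hg1 : g ≤ 1)
    (hS0 : 0 ≤ S) (hSh : S < (h : ℝ)) (hhj : h ≤ j) (hhM : h ≤ M) (hhaG : j + 1 ≤ h + a)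
    (hhmid : S + (a : ℝ) * g * (1 - z) ≤ 2 * (h : ℝ))
    (hcov : y / (1 - y) * (1 - S / h) ≤ S / h * g) :
    DECAtT y (S + (a : ℝ) * g * (1 - z)) j (M + a) (weakMidLaw S g h a) := by
  classical
  have hh0 : (0 : ℝ) < h := lt_of_le_of_lt hS0 hSh
  have hSh' : 0 ≤ S / (h : ℝ) := div_nonneg hS0 hh0.le
  have hw0 : 0 ≤ 1 - S / (h : ℝ) := by rw [sub_nonneg, div_le_one hh0]; exact hSh.le
  have hW0 : ∀ p, 0 ≤ weakMidLaw S g h a p := fun p => weakMidLaw_nonneg S g h a hS0 hSh.le hg0 hg1 p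
  refine decAtT_of_flowAtT y _ j (M + a) _ hy0 hy1 (fun p hp => weakMidLaw_eq_zero S g h a p (by omega))
    (sum_weakMidLaw S g h a (M + a) (by omega)) ?_
  refine flowAtT_of_giants y _ j (M + a) _ hy0 hy1 hW0 ?_
  have hh1 : 1 ≤ h := by
    by_contra hc
    have : h = 0 := by omega
    subst this
    simp at hSh
    linarith
  have ha1 : 1 ≤ a := by omega
  -- lows: only the zero (h is a mid, h + a a giant)
  have hlow : ∑ l ∈ Finset.range (j + 1), (if 2 * (l : ℝ) < S + (a : ℝ) * g * (1 - z) then weakMidLaw S g h a l else 0)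
      ≤ 1 - S / h := by
    have hle : ∀ l ∈ Finset.range (j + 1),
        (if 2 * (l : ℝ) < S + (a : ℝ) * g * (1 - z) then weakMidLaw S g h a l else 0)
          ≤ (1 - S / h) * (if l = 0 then (1 : ℝ) else 0) := by
      intro l hl
      have hlj : l ≤ j := Nat.lt_succ_iff.1 (Finset.mem_range.1 hl)
      have hW : weakMidLaw S g h a l = (1 - S / h) * (if l = 0 then (1 : ℝ) else 0)
          + S / h * (1 - g) * (if l = h then (1 : ℝ) else 0) + S / h * g * (if l = h + a then (1 : ℝ) else 0) := rfl
      have hne : l ≠ h + a := by omega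
      by_cases hl0 : l = 0
      · subst hl0
        have e0 : weakMidLaw S g h a 0 = 1 - S / h := by
          rw [hW, if_pos rfl, if_neg (show ¬ (0 = h) by omega), if_neg (show ¬ (0 = h + a) by omega)]; ring
        rw [if_pos rfl, mul_one]
        split_ifs
        · exact le_of_eq e0
        · exact hw0
      · rw [if_neg hl0, mul_zero]
        by_cases hlh : l = h
        · subst hlh
          rw [if_neg (by linarith)]
        · split_ifs
          · rw [hW, if_neg hl0, if_neg hlh, if_neg hne]; linarith
          · exact le_rfl
    refine le_trans (Finset.sum_le_sum hle) ?_
    rw [← Finset.mul_sum, Finset.sum_ite_eq' (Finset.range (j + 1)) 0 (fun _ => (1 : ℝ)),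
      if_pos (Finset.mem_range.2 (Nat.succ_pos j)), mul_one]
  -- giants: at least the atom h + a
  have hgiant : S / h * g ≤ ∑ p ∈ Finset.Ico (j + 1) (M + a + 1), weakMidLaw S g h a p := by
    have hmem : h + a ∈ Finset.Ico (j + 1) (M + a + 1) := Finset.mem_Ico.2 ⟨hhaG, by omega⟩
    have := Finset.single_le_sum (fun p _ => hW0 p) hmem
    refine le_trans (le_of_eq ?_) this
    have hW : weakMidLaw S g h a (h + a) = (1 - S / h) * (if h + a = 0 then (1 : ℝ) else 0)
        + S / h * (1 - g) * (if h + a = h then (1 : ℝ) else 0) + S / h * g * (if h + a = h + a then (1 : ℝ) else 0) := rfl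
    rw [hW, if_neg (by omega), if_neg (by omega), if_pos rfl]
    ring
  calc y / (1 - y) * ∑ l ∈ Finset.range (j + 1), (if 2 * (l : ℝ) < S + (a : ℝ) * g * (1 - z) then weakMidLaw S g h a l else 0)
      ≤ y / (1 - y) * (1 - S / h) := mul_le_mul_of_nonneg_left hlow (div_pos hy0 (by linarith)).le
    _ ≤ S / h * g := hcov
    _ ≤ _ := hgiant

end LawDec

end Quant

end Summit.CriticalPhenomena.PercolationContinuityZ3.Theorems
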